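import Summits.NavierStokesRegularity.NavierStokesRegularity.Theorems.CalmPocketDoorDefs
import Summits.NavierStokesRegularity.NavierStokesRegularity.Theorems.QuietScarPocketDoorHolomorphicLimitTube
import Literature.Analysis.FluidPDE.ClassicalSolutionRescale

/-!
# CalmPocketDoorExteriorTube — ROUND-30 door S32 «CalmPocketDoor», plate F32:
# **`exteriorTraceTube_holds : ExteriorTraceTube`** (exterior terminal velocity trace with tube extension)

Seat nsreg-C26-p1 g4 (S-door lane; LEAD ns-s30-p1 g2 word 2026-08-28T11:59:45Z «F32 → C26-p1»); texts of record nsreg-p1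
`r30/Sketch32.lean` v2 d8e333116c9f1838 §0–§3 = tree `Theorems/CalmPocketDoorDefs.lean` (P0, ns-imp-p1 g4, p632304); plan
`r30/PLATE-AID-32.md` §F32.  `--supports stmt-NavierStokesRegularity-0056 --as helper`.

PROOF.  Fix `(M, R)`.  The local block `QuietScarPocketDoor.exists_uniform_terminalTraceTube` (F32a+b, p631198 / F32b) at
`r = 1/16`, `a = −1`, levels `(M, M)` gives `ρ, K > 0`.  For `(u,p)` of the exterior class and every centre `x` of the shell
`A_R = {½ ≤ ‖x‖ ≤ R}` the cylinder `(0,1) × B(x,¼)` lies in the exterior region `{¼ < ‖y‖ < 2R}` (`R ≥ 2`), so the time-shifted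
pair `(u,p)(1+s, ·)`, `s ∈ (−1,0)`, is classical on `(−1,0) × B(x, ¼)` with `‖u‖, |p| ≤ M`; the block yields a local trace `u₀ˣ`
(`u t → u₀ˣ` uniformly on `B(x,⅛)` as `t ↑ 1`) and a holomorphic `U₀ˣ` on `localComplexTube x (1/16) ρ`, `‖U₀ˣ‖ ≤ K`, with real
slice `u₀ˣ`.  GLOBAL TRACE `U₁ y := lim_{t↑1} u t y` (= `u₀ˣ y` on `B(x,⅛)`); uniform convergence on the compact shell from the
locally uniform convergence on the open cover (`tendstoLocallyUniformlyOn_biUnion`,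
`tendstoLocallyUniformlyOn_iff_forall_isCompact`).  GLUE (F32c) with `r₀ = min ρ (1/48)`: `F z := U₀^{c(z)} z` for a chosen
centre `c(z)` with `z ∈ B(complexify c(z), r₀)`; two local extensions with centres `< 2r₀` apart agree on
`localComplexTube x (1/16 − 2r₀) ρ` by the identity principle from the real ball
(`eqOn_localComplexTube_of_forall_complexify_eq`: both restrict to `complexify ∘ U₁`), and that tube contains
`B(complexify x, r₀)` (`3r₀ ≤ 1/16`, `r₀ ≤ ρ`); hence `F = U₀ˣ` on `B(complexify x, r₀)` for every `x ∈ A_R`: `F` is holomorphic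
on the tube `cTube A_R r₀`, bounded by `K`, and `F ∘ complexify = complexify ∘ U₁` on `A_R`.

HONEST FRAME: plate of the S32 regularity CRITERION (exterior calm pocket ⇒ regular; conditional on the Barker–Prange 2021
Prop. 10 tree fact by name at the closers); the class CONTAINS Type-II cores; item 0056 `NoTypeII` and Navier–Stokes regularity
are NOT proved and stay OPEN.
-/

noncomputable section

open MeasureTheory Set Function Filter Topology TopologicalSpace Metric
open scoped RealInnerProductSpace Topology ENNReal
open Literature.Analysis Literature.Analysis.FluidPDE
open Literature.Analysis.FunctionSpaces.EuclideanSpace (complexify norm_complexify)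
open Summit.NavierStokesRegularity.NavierStokesRegularity.Theorems.QuietScarPocketDoor (exists_uniform_terminalTraceTube)

set_option linter.dupNamespace false

namespace Summit.NavierStokesRegularity.NavierStokesRegularity.Theorems.CalmPocketDoor


/-- The exterior shell `A_R = {½ ≤ ‖x‖ ≤ R}` is compact. -/
theorem isCompact_shell (R : ℝ) : IsCompact (shell R) := by
  have hc : IsClosed (shell R) := by
    have : shell R = (fun x : EuclideanSpace ℝ (Fin 3) => ‖x‖) ⁻¹' Icc (1 / 2) R := by
      ext x; simp [shell, mem_Icc]
    rw [this]
    exact isClosed_Icc.preimage continuous_norm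
  refine Metric.isCompact_of_isClosed_isBounded hc ?_
  refine (Metric.isBounded_closedBall (x := (0 : EuclideanSpace ℝ (Fin 3))) (r := R)).subset fun x hx => ?_
  rw [mem_closedBall, dist_zero_right]
  exact hx.2

/-- The time shift `t ↦ t − 1` maps `t ↑ 1` to `s ↑ 0`. -/
theorem tendsto_sub_one_nhdsLT : Tendsto (fun t : ℝ => t - 1) (𝓝[<] (1 : ℝ)) (𝓝[<] (0 : ℝ)) := by
  refine tendsto_nhdsWithin_of_tendsto_nhds_of_eventually_within _ ?_ ?_
  · have hc : Continuous fun t : ℝ => t - 1 := continuous_id.sub continuous_const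
    simpa using (hc.tendsto (1 : ℝ)).mono_left nhdsWithin_le_nhds
  · filter_upwards [self_mem_nhdsWithin] with t ht
    have ht' : t < 1 := ht
    show t - 1 < 0
    linarith

/-- **The time-shifted pair is classical on every shell cylinder.**  For `(u,p)` classical on `[0,1) × ℝ³` (`ν = 1`), the pair
`(s,y) ↦ (u,p)(1+s, y)` is a classical solution on the region `(−1,0) × B(x, ¼)` (any centre `x`). -/
theorem shifted_isClassical_region {u : ℝ → EuclideanSpace ℝ (Fin 3) → EuclideanSpace ℝ (Fin 3)}
    {p : ℝ → EuclideanSpace ℝ (Fin 3) → ℝ} (hcl : IsClassicalNSSolutionOn (Ico (0 : ℝ) 1) 1 0 u p)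
    (x : EuclideanSpace ℝ (Fin 3)) :
    IsClassicalNSSolutionOnRegion (Ioo (-1 : ℝ) 0 ×ˢ ball x (4 * (1 / 16)))
      1 0 (fun s y => u (1 + s) y) (fun s y => p (1 + s) y) := by
  have h := hcl.nsRescale_translate_zero one_pos 1 0
  have hS : (fun r : ℝ => (1 : ℝ) + (1 : ℝ) ^ 2 * r) ⁻¹' Ico (0 : ℝ) 1 = Ico (-1 : ℝ) 0 := by
    ext r
    simp only [mem_preimage, mem_Ico, one_pow, one_mul]
    constructor <;> rintro ⟨h1, h2⟩ <;> constructor <;> linarith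
  have hu' : (1 : ℝ) • stPull ((1 : ℝ) ^ 2) 1 1 0 u = fun s y => u (1 + s) y := by
    funext s y; simp [stPull_apply]
  have hp' : ((1 : ℝ) ^ 2) • stPull ((1 : ℝ) ^ 2) 1 1 0 p = fun s y => p (1 + s) y := by
    funext s y; simp [stPull_apply]
  rw [hS, hu', hp'] at h
  have h0 : IsClassicalNSSolutionOn (Ioo (-1 : ℝ) 0) 1 0 (fun s y => u (1 + s) y) (fun s y => p (1 + s) y) :=
    h.mono Ioo_subset_Ico_self (uniqueDiffOn_Ioo _ _)
  exact h0.onRegion.mono_of_isOpen (prod_mono le_rfl (subset_univ _)) (isOpen_Ioo.prod isOpen_ball)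

/-- Points of a shell cylinder lie in the exterior region: `x ∈ A_R`, `y ∈ B(x, ¼)`, `R ≥ 2` ⇒ `¼ < ‖y‖ < 2R`. -/
theorem exterior_of_mem_ball_shell {R : ℝ} (hR : 2 ≤ R) {x y : EuclideanSpace ℝ (Fin 3)} (hx : x ∈ shell R)
    (hy : y ∈ ball x (4 * (1 / 16))) : 1 / 4 < ‖y‖ ∧ ‖y‖ < 2 * R := by
  rw [mem_ball, dist_eq_norm] at hy
  obtain ⟨hx1, hx2⟩ := hx
  have h1 : ‖x‖ ≤ ‖y‖ + ‖y - x‖ := by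
    have := norm_sub_norm_le x y
    rw [← norm_neg (x - y), neg_sub] at this
    linarith
  have h2 : ‖y‖ ≤ ‖x‖ + ‖y - x‖ := by
    have := norm_sub_norm_le y x
    linarith
  constructor <;> linarith

/-- **PLATE F32 · `ExteriorTraceTube` HOLDS** (module docstring): for the exterior class `(M,R)` the velocities `u(t,·)`
converge uniformly on the shell `A_R` as `t ↑ 1` to a field `U₁` with tube data `(r₀, K₀)` depending only on `(M, R)` — in fact
only on `M`: `r₀ = min ρ(M) (1/48)`, `K₀ = K(M)` from the uniform local block at `r = 1/16`, `a = −1`.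
[cite: BradshawGrujicKukavica2015, Thm. 2.3 and (4.9) p. 19; SereginSverak2009, §2 p. 8] -/
theorem exteriorTraceTube_holds : ExteriorTraceTube := by
  intro M R hM hR
  obtain ⟨ρ, K, hρ, hK, hblock⟩ := exists_uniform_terminalTraceTube (r := 1 / 16) (a := -1) (M := M) (P := M)
    (by norm_num) (by norm_num) hM.le hM.le
  set r₀ : ℝ := min ρ (1 / 48) with hr₀_def
  have hr₀ : 0 < r₀ := lt_min hρ (by norm_num)
  have hr₀ρ : r₀ ≤ ρ := min_le_left _ _
  have hr₀s : r₀ ≤ 1 / 48 := min_le_right _ _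
  refine ⟨r₀, K, hr₀, hK, fun u p hcl => ?_⟩
  obtain ⟨hcls, -, -, hext⟩ := hcl
  -- the time-shifted pair
  set us : ℝ → EuclideanSpace ℝ (Fin 3) → EuclideanSpace ℝ (Fin 3) := fun s y => u (1 + s) y with hus
  set ps : ℝ → EuclideanSpace ℝ (Fin 3) → ℝ := fun s y => p (1 + s) y with hps
  have hreg : ∀ x ∈ shell R, IsClassicalNSSolutionOnRegion (Ioo (-1 : ℝ) 0 ×ˢ ball x (4 * (1 / 16))) 1 0 us ps :=
    fun x _ => shifted_isClassical_region hcls x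
  have hbdM : ∀ x ∈ shell R, ∀ s ∈ Ioo (-1 : ℝ) 0, ∀ y ∈ ball x (4 * (1 / 16)), ‖us s y‖ ≤ M := by
    intro x hx s hs y hy
    obtain ⟨h1, h2⟩ := exterior_of_mem_ball_shell hR hx hy
    exact (hext (1 + s) ⟨by linarith [hs.1], by linarith [hs.2]⟩ y h1 h2).1
  have hbdP : ∀ x ∈ shell R, ∀ s ∈ Ioo (-1 : ℝ) 0, ∀ y ∈ ball x (4 * (1 / 16)), |ps s y| ≤ M := by
    intro x hx s hs y hy
    obtain ⟨h1, h2⟩ := exterior_of_mem_ball_shell hR hx hy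
    exact (hext (1 + s) ⟨by linarith [hs.1], by linarith [hs.2]⟩ y h1 h2).2
  -- local traces and local tube extensions at every centre of the shell
  have hdata : ∀ x ∈ shell R, ∃ (u₀ : EuclideanSpace ℝ (Fin 3) → EuclideanSpace ℝ (Fin 3))
      (U₀ : EuclideanSpace ℂ (Fin 3) → EuclideanSpace ℂ (Fin 3)),
      TendstoUniformlyOn (fun s => us s) u₀ (𝓝[<] (0 : ℝ)) (ball x (2 * (1 / 16))) ∧
      DifferentiableOn ℂ U₀ (localComplexTube x (1 / 16) ρ) ∧
      (∀ z ∈ localComplexTube x (1 / 16) ρ, ‖U₀ z‖ ≤ K) ∧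
      ∀ y ∈ ball x (1 / 16), U₀ (complexify y) = complexify (u₀ y) :=
    fun x hx => hblock x us ps (hreg x hx) (hbdM x hx) (hbdP x hx)
  choose! u₀ U₀ hcu hUd hUb hUr using hdata
  -- local uniform convergence of the physical slices as `t ↑ 1`
  have hconv : ∀ x ∈ shell R, TendstoUniformlyOn (fun t => u t) (u₀ x) (𝓝[<] (1 : ℝ)) (ball x (2 * (1 / 16))) := by
    intro x hx v hv
    have h1 := tendsto_sub_one_nhdsLT.eventually ((hcu x hx) v hv)
    filter_upwards [h1] with t ht y hy
    have h2 := ht y hy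
    simpa [hus] using h2
  -- the global trace
  set U₁ : EuclideanSpace ℝ (Fin 3) → EuclideanSpace ℝ (Fin 3) :=
    fun y => limUnder (𝓝[<] (1 : ℝ)) (fun t => u t y) with hU₁_def
  have hU₁ : ∀ x ∈ shell R, ∀ y ∈ ball x (2 * (1 / 16)), U₁ y = u₀ x y :=
    fun x hx y hy => ((hconv x hx).tendsto_at hy).limUnder_eq
  have hconv' : ∀ x ∈ shell R, TendstoUniformlyOn (fun t => u t) U₁ (𝓝[<] (1 : ℝ)) (ball x (2 * (1 / 16))) :=
    fun x hx => (hconv x hx).congr_right fun y hy => (hU₁ x hx y hy).symm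
  -- (1) uniform convergence on the compact shell
  have hOpen : IsOpen (⋃ x ∈ shell R, ball x (2 * (1 / 16) : ℝ)) := isOpen_biUnion fun _ _ => isOpen_ball
  have hloc : TendstoLocallyUniformlyOn (fun t => u t) U₁ (𝓝[<] (1 : ℝ)) (⋃ x ∈ shell R, ball x (2 * (1 / 16))) :=
    tendstoLocallyUniformlyOn_biUnion (fun _ _ => isOpen_ball) fun x hx => (hconv' x hx).tendstoLocallyUniformlyOn
  have hcover : shell R ⊆ ⋃ x ∈ shell R, ball x (2 * (1 / 16) : ℝ) :=
    fun x hx => mem_biUnion hx (mem_ball_self (by norm_num))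
  have hunif : TendstoUniformlyOn (fun t => u t) U₁ (𝓝[<] (1 : ℝ)) (shell R) :=
    (tendstoLocallyUniformlyOn_iff_forall_isCompact hOpen).1 hloc _ hcover (isCompact_shell R)
  refine ⟨U₁, hunif, ?_⟩
  -- (2) the glue
  -- two local extensions with close centres agree near the first centre
  have hagree : ∀ x ∈ shell R, ∀ x' ∈ shell R, dist x x' < 2 * r₀ →
      EqOn (U₀ x) (U₀ x') (localComplexTube x (1 / 16 - 2 * r₀) ρ) := by
    intro x hx x' hx' hd
    have hsub1 : localComplexTube x (1 / 16 - 2 * r₀) ρ ⊆ localComplexTube x (1 / 16) ρ :=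
      localComplexTube_mono (by linarith) le_rfl
    have hsub2 : localComplexTube x (1 / 16 - 2 * r₀) ρ ⊆ localComplexTube x' (1 / 16) ρ := by
      rintro z ⟨a, b, ha, hb, rfl⟩
      refine ⟨a, b, ?_, hb, rfl⟩
      calc dist a x' ≤ dist a x + dist x x' := dist_triangle _ _ _
        _ < 1 / 16 - 2 * r₀ + 2 * r₀ := by linarith
        _ = 1 / 16 := by ring
    refine eqOn_localComplexTube_of_forall_complexify_eq ((hUd x hx).mono hsub1) ((hUd x' hx').mono hsub2) ?_
    intro y hy
    rw [mem_ball] at hy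
    have hy1 : y ∈ ball x (1 / 16) := mem_ball.2 (by linarith)
    have hy2 : y ∈ ball x' (1 / 16) := by
      rw [mem_ball]
      calc dist y x' ≤ dist y x + dist x x' := dist_triangle _ _ _
        _ < 1 / 16 - 2 * r₀ + 2 * r₀ := by linarith
        _ = 1 / 16 := by ring
    have hy1' : y ∈ ball x (2 * (1 / 16)) := ball_subset_ball (by norm_num) hy1
    have hy2' : y ∈ ball x' (2 * (1 / 16)) := ball_subset_ball (by norm_num) hy2
    rw [hUr x hx y hy1, hUr x' hx' y hy2, ← hU₁ x hx y hy1', ← hU₁ x' hx' y hy2']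
  -- complex balls of radius `r₀` about real centres sit inside the local tubes
  have hballT : ∀ x : EuclideanSpace ℝ (Fin 3), ball (complexify x) r₀ ⊆ localComplexTube x (1 / 16 - 2 * r₀) ρ :=
    fun x => ball_complexify_subset_localComplexTube (by rw [dist_self]; linarith) hr₀ρ
  have hballT' : ∀ x : EuclideanSpace ℝ (Fin 3), ball (complexify x) r₀ ⊆ localComplexTube x (1 / 16) ρ :=
    fun x => (hballT x).trans (localComplexTube_mono (by linarith) le_rfl)
  -- the chart and the glued map
  have hchart : ∀ z ∈ cTube (shell R) r₀, ∃ x ∈ shell R, z ∈ ball (complexify x) r₀ := by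
    intro z hz
    simpa only [cTube, mem_iUnion, exists_prop] using hz
  choose! c hc hcz using hchart
  set F : EuclideanSpace ℂ (Fin 3) → EuclideanSpace ℂ (Fin 3) := fun z => U₀ (c z) z with hF_def
  -- `F = U₀ x` on `B(complexify x, r₀)` for every centre `x` of the shell
  have hFloc : ∀ x ∈ shell R, ∀ z ∈ ball (complexify x) r₀, F z = U₀ x z := by
    intro x hx z hz
    have hzT : z ∈ cTube (shell R) r₀ := by
      simp only [cTube, mem_iUnion, exists_prop]
      exact ⟨x, hx, hz⟩
    have hx' := hc z hzT
    have hz' := hcz z hzT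
    have hd : dist x (c z) < 2 * r₀ := by
      have e : dist x (c z) = dist (complexify x) (complexify (c z)) := by
        rw [dist_eq_norm, dist_eq_norm, ← map_sub, norm_complexify]
      rw [e]
      rw [mem_ball] at hz hz'
      calc dist (complexify x) (complexify (c z)) ≤ dist (complexify x) z + dist z (complexify (c z)) := dist_triangle _ _ _
        _ < r₀ + r₀ := by rw [dist_comm]; exact add_lt_add hz hz'
        _ = 2 * r₀ := by ring
    rw [hF_def]
    exact ((hagree x hx (c z) hx' hd) (hballT x hz)).symm
  refine ⟨F, ?_, ?_, ?_⟩
  · -- holomorphy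
    intro z hz
    have hx := hc z hz
    have hzb := hcz z hz
    have hev : F =ᶠ[𝓝 z] U₀ (c z) := by
      filter_upwards [isOpen_ball.mem_nhds hzb] with w hw
      exact hFloc (c z) hx w hw
    have hdiff : DifferentiableAt ℂ (U₀ (c z)) z :=
      ((hUd (c z) hx) z (hballT' (c z) hzb)).differentiableAt
        ((isOpen_localComplexTube _ _ _).mem_nhds (hballT' (c z) hzb))
    exact (hev.differentiableAt_iff.2 hdiff).differentiableWithinAt
  · -- the bound
    intro z hz
    rw [hF_def]
    exact hUb (c z) (hc z hz) z (hballT' (c z) (hcz z hz))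
  · -- the real slice
    intro x hx
    have hxx : x ∈ ball x (2 * (1 / 16)) := mem_ball_self (by norm_num)
    rw [hFloc x hx (complexify x) (mem_ball_self hr₀), hUr x hx x (mem_ball_self (by norm_num)), ← hU₁ x hx x hxx]

end Summit.NavierStokesRegularity.NavierStokesRegularity.Theorems.CalmPocketDoor

end
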